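import Literature.Geometry.Symplectic.SurfaceTubeModelForm
import Literature.Geometry.Symplectic.SurfaceTubeRelativePoincare
import Literature.Geometry.Symplectic.MoserVectorFour
import Literature.Geometry.Symplectic.OrigamiFoldKernelField
import Literature.Geometry.Kaehler.FibrePrimitiveProductSmooth
import Mathlib.Geometry.Manifold.VectorBundle.Tangent
import HarnessLib

/-!
# The Moser vector field of the tube of a symplectic surface

Topic `Literature/Geometry/Symplectic`; layer C6a of the construction of the symplectic tubular
neighbourhood with its `U(1)`-structure of a closed symplectic surface `b : S → N` in a
symplectic `4`-manifold (McLean, GAFA 2012, **Lemma 5.14**, `k = 1`; the symplectic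
neighbourhood theorem, McDuff–Salamon 2017, Thm. 3.4.10, by Moser's argument, §3.2), for the
fact seat of `Literature.Geometry.Symplectic.mclean_divisorComplement_convex_four`.

With the model form `s_M` (`SurfaceTubeModelForm.lean`, `s_M = s` on `T_B N`) and the relative
Poincaré primitive (`SurfaceTubeRelativePoincare.lean`) we set `τ = s - s_M`, `β = prim τ`
(`dβ = τ` on the quarter tube, `β = 0` on the surface) and `s_t = s_M + t τ`, and build the
**Moser vector field** `Y_t` with `ι(Y_t) s_t = -β`:

* `moserE4 α μ` — the Moser vector of a `2`-form `α` with `Pf α ≠ 0` and a `1`-form `μ` on `ℝ⁴`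
  (`alt_two_moserVector` of `MoserVectorFour.lean`): `α (moserE4, w) = -μ (w)`, uniqueness,
  naturality under linear isomorphisms (`moserE4_comp`), smoothness in `(α, μ)`;
* `Setup.O₂` — an open neighbourhood of the surface inside the quarter tube on which
  `Pf (s_t x) ≠ 0` for all `t ∈ [-1, 2]` (`s_t = s` at the surface is non-degenerate;
  continuity of the chart Pfaffian and compactness of `[-1, 2]`);
* `Setup.Y t x = moserE4 (s_t x) (β x)`: the Moser equation `s_t (Y_t, ·) = -β` on `O₂`
  (`sFam_Y`), `Y_t = 0` on the surface (`Y_b`), the chart representatives `A`, `Bμ` and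
  **smoothness as a time-dependent vector field** on `(-1, 2) × O₂` (`contMDiffOn_Y`, the
  pattern of `GrayStabilityField.lean`: in the trivialization at `x₀` the field is the Moser
  vector of the chart representatives, by naturality).

Everything here is proved; no named facts (D-0026).

## References

* D. McDuff, D. Salamon, *Introduction to Symplectic Topology*, 3rd ed. (2017), §3.2 (Moser's
  argument), Thm. 3.4.10. [McDuffSalamon2017]
* M. McLean, *The growth rate of symplectic homology and affine varieties*, GAFA 22 (2012),
  Lemma 5.14 (arXiv:1011.2542). [Mclean2012]
-/

noncomputable section

open scoped Manifold ContDiff Topology RealInnerProductSpace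
open Set Function Module Filter Metric Bundle
open Literature.Topology.FourManifolds
open Literature.Geometry.Kaehler
open Literature.Geometry.Manifold

namespace Literature.Geometry.Symplectic

namespace SurfaceTube

/-- Local notation for the model space. -/
local notation "E4" => EuclideanSpace ℝ (Fin 4)

/-! ### The Moser vector on `ℝ⁴` -/

section MoserE4

/-- **The Moser vector** of a `2`-form `α` and a `1`-form `μ` on `ℝ⁴`:
`(Pf α)⁻¹ Σ_k μ(e_k) adj_k(α)`, the solution of `α (v, ·) = -μ` when `Pf α ≠ 0`.
[cite: McDuffSalamon2017, §3.2] -/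
def moserE4 (α : E4 [⋀^Fin 2]→L[ℝ] ℝ) (μ : E4 [⋀^Fin 1]→L[ℝ] ℝ) : E4 :=
  (pfaffian α)⁻¹ • ∑ k, μ ![stdVec k] • pfaffAdjCol α k

/-- **The Moser equation**: `α (moserE4 α μ, w) = -μ (w)` for `Pf α ≠ 0`. [cite: McDuffSalamon2017, §3.2] -/
theorem alt_two_moserE4 {α : E4 [⋀^Fin 2]→L[ℝ] ℝ} (hP : pfaffian α ≠ 0) (μ : E4 [⋀^Fin 1]→L[ℝ] ℝ)
    (w : E4) : α ![moserE4 α μ, w] = -μ ![w] :=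
  alt_two_moserVector α hP μ w

/-- **Non-degeneracy**: for `Pf α ≠ 0`, a vector is determined by `α (v, ·)`. [folklore] -/
theorem eq_of_forall_alt_two_eq {α : E4 [⋀^Fin 2]→L[ℝ] ℝ} (hP : pfaffian α ≠ 0) {v v' : E4}
    (h : ∀ w, α ![v, w] = α ![v', w]) : v = v' := by
  by_contra hne
  apply hP
  rw [pfaffian_eq_zero_iff]
  refine ⟨v - v', sub_ne_zero.2 hne, fun w ↦ ?_⟩
  rw [show v - v' = v + (-1 : ℝ) • v' by rw [neg_one_smul, sub_eq_add_neg], alt_two_add_left,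
    alt_two_smul_left, h w]
  ring

/-- **Uniqueness of the Moser vector.** [folklore] -/
theorem moserE4_unique {α : E4 [⋀^Fin 2]→L[ℝ] ℝ} (hP : pfaffian α ≠ 0) {μ : E4 [⋀^Fin 1]→L[ℝ] ℝ}
    {v : E4} (hv : ∀ w, α ![v, w] = -μ ![w]) : v = moserE4 α μ :=
  eq_of_forall_alt_two_eq hP fun w ↦ by rw [hv, alt_two_moserE4 hP]

/-- The zero `1`-form has zero Moser vector. [folklore] -/
theorem moserE4_zero (α : E4 [⋀^Fin 2]→L[ℝ] ℝ) : moserE4 α 0 = 0 := by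
  simp [moserE4]

/-- Composition of a pair of vectors with a linear map. [folklore] -/
theorem comp_vec2 (L : E4 →L[ℝ] E4) (v w : E4) : (L : E4 → E4) ∘ ![v, w] = ![L v, L w] := by
  funext i; fin_cases i <;> rfl

/-- Composition of a single vector with a linear map. [folklore] -/
theorem comp_vec1 (L : E4 →L[ℝ] E4) (w : E4) : (L : E4 → E4) ∘ ![w] = ![L w] := by
  funext i; fin_cases i; rfl

/-- **The Pfaffian of a form pulled back along an invertible linear map vanishes iff the
Pfaffian of the form does** (kernel vectors correspond). [folklore] -/
theorem pfaffian_comp_eq_zero_iff (α : E4 [⋀^Fin 2]→L[ℝ] ℝ) {L L' : E4 →L[ℝ] E4}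
    (h₁ : ∀ v, L (L' v) = v) (h₂ : ∀ v, L' (L v) = v) :
    pfaffian (α.compContinuousLinearMap L) = 0 ↔ pfaffian α = 0 := by
  rw [pfaffian_eq_zero_iff, pfaffian_eq_zero_iff]
  constructor
  · rintro ⟨v, hv, hker⟩
    refine ⟨L v, fun h ↦ hv ?_, fun w ↦ ?_⟩
    · rw [← h₂ v, h, map_zero]
    · have := hker (L' w)
      rwa [ContinuousAlternatingMap.compContinuousLinearMap_apply, comp_vec2, h₁] at this
  · rintro ⟨v, hv, hker⟩
    refine ⟨L' v, fun h ↦ hv ?_, fun w ↦ ?_⟩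
    · rw [← h₁ v, h, map_zero]
    · rw [ContinuousAlternatingMap.compContinuousLinearMap_apply, comp_vec2, h₁]
      exact hker _

/-- **Naturality of the Moser vector**: `moserE4 (α ∘ L) (μ ∘ L) = L⁻¹ (moserE4 α μ)` for an
invertible linear map `L` with inverse `L'`. [folklore] -/
theorem moserE4_comp {α : E4 [⋀^Fin 2]→L[ℝ] ℝ} (hP : pfaffian α ≠ 0) (μ : E4 [⋀^Fin 1]→L[ℝ] ℝ)
    {L L' : E4 →L[ℝ] E4} (h₁ : ∀ v, L (L' v) = v) (h₂ : ∀ v, L' (L v) = v) :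
    moserE4 (α.compContinuousLinearMap L) (μ.compContinuousLinearMap L) = L' (moserE4 α μ) := by
  symm
  have hP' : pfaffian (α.compContinuousLinearMap L) ≠ 0 :=
    fun h ↦ hP ((pfaffian_comp_eq_zero_iff α h₁ h₂).1 h)
  refine moserE4_unique hP' fun w ↦ ?_
  rw [ContinuousAlternatingMap.compContinuousLinearMap_apply,
    ContinuousAlternatingMap.compContinuousLinearMap_apply, comp_vec2, comp_vec1, h₁,
    alt_two_moserE4 hP]

/-- Evaluation of a `1`-form on `ℝ⁴` at a fixed vector is smooth in the form. [folklore] -/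
theorem contDiff_alt_one_eval' (v : Fin 1 → E4) :
    ContDiff ℝ ∞ fun μ : E4 [⋀^Fin 1]→L[ℝ] ℝ ↦ μ v :=
  (ContinuousAlternatingMap.apply ℝ E4 ℝ v).contDiff

/-- **The Moser vector is smooth in `(α, μ)` where `Pf α ≠ 0`.** [folklore] -/
theorem contDiffAt_moserE4 {p : (E4 [⋀^Fin 2]→L[ℝ] ℝ) × (E4 [⋀^Fin 1]→L[ℝ] ℝ)}
    (hp : pfaffian p.1 ≠ 0) :
    ContDiffAt ℝ ∞ (fun p : (E4 [⋀^Fin 2]→L[ℝ] ℝ) × (E4 [⋀^Fin 1]→L[ℝ] ℝ) ↦ moserE4 p.1 p.2) p := by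
  have hpf : ContDiffAt ℝ ∞ (fun p : (E4 [⋀^Fin 2]→L[ℝ] ℝ) × (E4 [⋀^Fin 1]→L[ℝ] ℝ) ↦
      (pfaffian p.1)⁻¹) p := (contDiff_pfaffian.contDiffAt.comp p contDiffAt_fst).inv hp
  have hsum : ContDiff ℝ ∞ (fun p : (E4 [⋀^Fin 2]→L[ℝ] ℝ) × (E4 [⋀^Fin 1]→L[ℝ] ℝ) ↦
      ∑ k, p.2 ![stdVec k] • pfaffAdjCol p.1 k) :=
    ContDiff.sum fun k _ ↦ ((contDiff_alt_one_eval' _).comp contDiff_snd).smul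
      ((contDiff_pfaffAdjCol k).comp contDiff_fst)
  exact hpf.smul hsum.contDiffAt

end MoserE4

/-! ### The data of the Moser argument on the tube -/

section Cancel

variable {N : Type*} [TopologicalSpace N] [ChartedSpace (EuclideanSpace ℝ (Fin 4)) N]
  [IsManifold (𝓡 4) ∞ N]

/-- On a chart overlap the tangent coordinate changes `z → x₀ → z` cancel. [folklore] -/
theorem tangentCoordChange_cancel {x₀ z : N} (hz : z ∈ (extChartAt (𝓡 4) x₀).source) (v : E4) :
    tangentCoordChange (𝓡 4) x₀ z z (tangentCoordChange (𝓡 4) z x₀ z v) = v := by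
  rw [tangentCoordChange_comp ⟨⟨mem_extChartAt_source z, hz⟩, mem_extChartAt_source z⟩,
    tangentCoordChange_self (mem_extChartAt_source z)]

/-- On a chart overlap the tangent coordinate changes `x₀ → z → x₀` cancel (at `z`). [folklore] -/
theorem tangentCoordChange_cancel' {x₀ z : N} (hz : z ∈ (extChartAt (𝓡 4) x₀).source) (v : E4) :
    tangentCoordChange (𝓡 4) z x₀ z (tangentCoordChange (𝓡 4) x₀ z z v) = v := by
  rw [tangentCoordChange_comp ⟨⟨hz, mem_extChartAt_source z⟩, hz⟩, tangentCoordChange_self hz]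

end Cancel

variable {N : Type*} [TopologicalSpace N] [ChartedSpace (EuclideanSpace ℝ (Fin 4)) N]
  [IsManifold (𝓡 4) ∞ N] {S : Type*} [TopologicalSpace S] [ChartedSpace (EuclideanSpace ℝ (Fin 2)) S]
  [IsManifold (𝓡 2) ∞ S] {V : Type*} [NormedAddCommGroup V] [InnerProductSpace ℝ V]
  [FiniteDimensional ℝ V] (D : Setup N S V)

namespace Setup

/-- **`Pf (s x) ≠ 0`**: the symplectic form is non-degenerate. [folklore] -/
theorem pfaffian_s_ne_zero (x : N) : pfaffian (D.s x) ≠ 0 := by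
  intro h
  obtain ⟨v, hv, hker⟩ := (pfaffian_eq_zero_iff _).1 h
  obtain ⟨w, hw⟩ := D.hnd x v hv
  exact hw (hker w)

section NoT2

variable [CompactSpace S] [Nonempty S]

/-- **`τ = s - s_M`**: the defect of the model form, vanishing on `T_B N`. [folklore] -/
def τ : MForm (𝓡 4) N ℝ 2 := D.s - D.sM

/-- `τ` is smooth on `N₁`. [folklore] -/
theorem smoothAt_τ {x : N} (hx : x ∈ D.N₁) : D.τ.SmoothAt x := (D.smoothAt_s x).sub (D.smoothAt_sM hx)

/-- `τ` is closed on `N₁`. [folklore] -/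
theorem mextDeriv_τ {x : N} (hx : x ∈ D.N₁) : mextDeriv D.τ x = 0 := by
  have h : D.τ = D.s + (-1 : ℝ) • D.sM := by
    rw [τ, neg_one_smul, sub_eq_add_neg]
  have hsc : mextDeriv D.s = 0 := D.hsc
  rw [h, mextDeriv_add_apply (D.smoothAt_s x) ((D.smoothAt_sM hx).smul _), mextDeriv_smul,
    Pi.smul_apply, D.mextDeriv_sM hx, smul_zero, add_zero, hsc]
  rfl

/-- `τ` vanishes at the points of the surface. [folklore] -/
theorem τ_b (y : S) : D.τ (D.b y) = 0 := by
  show D.s (D.b y) - D.sM (D.b y) = 0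
  rw [D.sM_b, sub_self]

/-- **The Moser family** `s_t = s_M + t τ` (`s_0 = s_M`, `s_1 = s`). [cite: McDuffSalamon2017, §3.2] -/
def sFam (t : ℝ) : MForm (𝓡 4) N ℝ 2 := D.sM + t • D.τ

/-- `s_0 = s_M`. [folklore] -/
theorem sFam_zero : D.sFam 0 = D.sM := by rw [sFam, zero_smul, add_zero]

/-- `s_1 = s`. [folklore] -/
theorem sFam_one : D.sFam 1 = D.s := by
  rw [sFam, one_smul, τ, add_sub_cancel]

/-- Value of `s_t`. [folklore] -/
theorem sFam_apply (t : ℝ) (x : N) : D.sFam t x = D.sM x + t • D.τ x := rfl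

/-- `s_t` is smooth on `N₁`. [folklore] -/
theorem smoothAt_sFam (t : ℝ) {x : N} (hx : x ∈ D.N₁) : (D.sFam t).SmoothAt x :=
  (D.smoothAt_sM hx).add ((D.smoothAt_τ hx).smul t)

/-- **`s_t` is closed on `N₁`.** [folklore] -/
theorem mextDeriv_sFam (t : ℝ) {x : N} (hx : x ∈ D.N₁) : mextDeriv (D.sFam t) x = 0 := by
  rw [sFam, mextDeriv_add_apply (D.smoothAt_sM hx) ((D.smoothAt_τ hx).smul t), mextDeriv_smul,
    Pi.smul_apply, D.mextDeriv_sM hx, D.mextDeriv_τ hx, smul_zero, add_zero]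

/-- **`s_t = s` at the points of the surface.** [folklore] -/
theorem sFam_b (t : ℝ) (y : S) : D.sFam t (D.b y) = D.s (D.b y) := by
  rw [D.sFam_apply, D.τ_b, smul_zero, add_zero, D.sM_b]

/-- `Pf (s_t (b y)) ≠ 0` for all `t`. [folklore] -/
theorem pfaffian_sFam_b_ne_zero (t : ℝ) (y : S) : pfaffian (D.sFam t (D.b y)) ≠ 0 := by
  rw [D.sFam_b]; exact D.pfaffian_s_ne_zero _

/-! ### The chart representatives -/

/-- **The chart representative of the family** in the chart at `x₀`:
`Arep x₀ (t, q) = (s_t).inChart x₀ q`. [folklore] -/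
def Arep (x₀ : N) (p : ℝ × E4) : E4 [⋀^Fin 2]→L[ℝ] ℝ := (D.sFam p.1).inChart x₀ p.2

/-- `A` is affine in `t`: `A x₀ (t, q) = s_M.inChart x₀ q + t • τ.inChart x₀ q`. [folklore] -/
theorem Arep_eq_add (x₀ : N) (p : ℝ × E4) : D.Arep x₀ p = D.sM.inChart x₀ p.2 + p.1 • D.τ.inChart x₀ p.2 := by
  rw [Arep, sFam, MForm.inChart_add, MForm.inChart_smul]
  rfl

/-- The good part of the chart target at `x₀`: chart points over `N₁`. [folklore] -/
def tgt₁ (x₀ : N) : Set E4 := (extChartAt (𝓡 4) x₀).target ∩ (extChartAt (𝓡 4) x₀).symm ⁻¹' D.N₁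

/-- `tgt₁` is open. [folklore] -/
theorem isOpen_tgt₁ (x₀ : N) : IsOpen (D.tgt₁ x₀) :=
  (continuousOn_extChartAt_symm x₀).isOpen_inter_preimage (isOpen_extChartAt_target x₀) D.isOpen_N₁

/-- The chart representative of a form smooth at the points over `q` is `C^∞` at `q`. [folklore] -/
theorem contDiffAt_inChart_of_smoothAt {α : MForm (𝓡 4) N ℝ 2} (x₀ : N) {q : E4}
    (hq : q ∈ (extChartAt (𝓡 4) x₀).target) (h : α.SmoothAt ((extChartAt (𝓡 4) x₀).symm q)) :
    ContDiffAt ℝ ∞ (α.inChart x₀) q := by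
  have hzs : (extChartAt (𝓡 4) x₀).symm q ∈ (extChartAt (𝓡 4) x₀).source :=
    (extChartAt (𝓡 4) x₀).map_target hq
  have h1 := MForm.SmoothAt.contDiffWithinAt_inChart hzs h
  rw [(extChartAt (𝓡 4) x₀).right_inv hq, ModelWithCorners.Boundaryless.range_eq_univ,
    contDiffWithinAt_univ] at h1
  exact h1

/-- The chart representative of a `1`-form smooth at the point over `q` is `C^∞` at `q`. [folklore] -/
theorem contDiffAt_inChart_of_smoothAt₁ {α : MForm (𝓡 4) N ℝ 1} (x₀ : N) {q : E4}
    (hq : q ∈ (extChartAt (𝓡 4) x₀).target) (h : α.SmoothAt ((extChartAt (𝓡 4) x₀).symm q)) :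
    ContDiffAt ℝ ∞ (α.inChart x₀) q := by
  have hzs : (extChartAt (𝓡 4) x₀).symm q ∈ (extChartAt (𝓡 4) x₀).source :=
    (extChartAt (𝓡 4) x₀).map_target hq
  have h1 := MForm.SmoothAt.contDiffWithinAt_inChart hzs h
  rw [(extChartAt (𝓡 4) x₀).right_inv hq, ModelWithCorners.Boundaryless.range_eq_univ,
    contDiffWithinAt_univ] at h1
  exact h1

/-- **`A` is jointly `C^∞`** on `ℝ × tgt₁`. [folklore] -/
theorem contDiffAt_Arep (x₀ : N) {p : ℝ × E4} (hp : p.2 ∈ D.tgt₁ x₀) : ContDiffAt ℝ ∞ (D.Arep x₀) p := by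
  have hM : ContDiffAt ℝ ∞ (D.sM.inChart x₀) p.2 :=
    contDiffAt_inChart_of_smoothAt x₀ hp.1 (D.smoothAt_sM hp.2)
  have hτ : ContDiffAt ℝ ∞ (D.τ.inChart x₀) p.2 :=
    contDiffAt_inChart_of_smoothAt x₀ hp.1 (D.smoothAt_τ hp.2)
  have h : D.Arep x₀ = fun p : ℝ × E4 ↦ D.sM.inChart x₀ p.2 + p.1 • D.τ.inChart x₀ p.2 :=
    funext fun p ↦ D.Arep_eq_add x₀ p
  rw [h]
  exact (hM.comp p contDiffAt_snd).add (contDiffAt_fst.smul (hτ.comp p contDiffAt_snd))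

/-- `A` in terms of the value of `s_t`: `A x₀ (t, φ z) = (s_t z) ∘ τ_{x₀ → z}`. [folklore] -/
theorem Arep_apply_of_mem_source (x₀ : N) (t : ℝ) {z : N} (hz : z ∈ (extChartAt (𝓡 4) x₀).source) :
    D.Arep x₀ (t, extChartAt (𝓡 4) x₀ z) =
      ((D.sFam t z : E4 [⋀^Fin 2]→L[ℝ] ℝ)).compContinuousLinearMap (tangentCoordChange (𝓡 4) x₀ z z) := by
  rw [Arep, MForm.inChart_eq_of_mem_target _ ((extChartAt (𝓡 4) x₀).map_source hz),
    (extChartAt (𝓡 4) x₀).left_inv hz]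

/-- **The chart Pfaffian does not vanish iff the Pfaffian of the value does not.** [folklore] -/
theorem pfaffian_Arep_ne_zero_iff (x₀ : N) (t : ℝ) {z : N} (hz : z ∈ (extChartAt (𝓡 4) x₀).source) :
    pfaffian (D.Arep x₀ (t, extChartAt (𝓡 4) x₀ z)) ≠ 0 ↔ pfaffian (D.sFam t z) ≠ 0 := by
  rw [D.Arep_apply_of_mem_source x₀ t hz]
  exact not_congr (pfaffian_comp_eq_zero_iff (D.sFam t z) (tangentCoordChange_cancel hz)
    (tangentCoordChange_cancel' hz))

/-! ### The good neighbourhood `O₂` of the surface -/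

/-- The compact time range of the Moser flow's cut-off support. [folklore] -/
abbrev Itime : Set ℝ := Icc (-1 : ℝ) 2

/-- **Every point of the surface has a neighbourhood on which `Pf (s_t) ≠ 0` for `t ∈ [-1, 2]`.**
[folklore] -/
theorem exists_nhds_pfaffian_ne_zero (y : S) :
    ∃ U ∈ 𝓝 (D.b y), ∀ z ∈ U, ∀ t ∈ Itime, pfaffian (D.sFam t z) ≠ 0 := by
  set x₀ := D.b y with hx₀
  set φ := extChartAt (𝓡 4) x₀ with hφ
  -- the chart Pfaffian is continuous on `ℝ × tgt₁`
  have hcont : ContinuousOn (fun p : ℝ × E4 ↦ pfaffian (D.Arep x₀ p)) (univ ×ˢ D.tgt₁ x₀) :=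
    fun p hp ↦ (continuous_pfaffian.continuousAt.comp (D.contDiffAt_Arep x₀ hp.2).continuousAt).continuousWithinAt
  have hopen : IsOpen ((univ ×ˢ D.tgt₁ x₀) ∩ (fun p : ℝ × E4 ↦ pfaffian (D.Arep x₀ p)) ⁻¹' {0}ᶜ) :=
    hcont.isOpen_inter_preimage (isOpen_univ.prod (D.isOpen_tgt₁ x₀)) isOpen_compl_singleton
  have hq₀ : φ x₀ ∈ D.tgt₁ x₀ := ⟨mem_extChartAt_target x₀, by
    show φ.symm (φ x₀) ∈ D.N₁; rw [extChartAt_to_inv]; exact D.b_mem_N₁ y⟩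
  have hsub : Itime ×ˢ ({φ x₀} : Set E4) ⊆
      (univ ×ˢ D.tgt₁ x₀) ∩ (fun p : ℝ × E4 ↦ pfaffian (D.Arep x₀ p)) ⁻¹' {0}ᶜ := by
    rintro ⟨t, q⟩ ⟨-, hq⟩
    rw [mem_singleton_iff] at hq
    subst hq
    refine ⟨⟨mem_univ _, hq₀⟩, ?_⟩
    show pfaffian (D.Arep x₀ (t, φ x₀)) ≠ 0
    rw [D.pfaffian_Arep_ne_zero_iff x₀ t (mem_extChartAt_source x₀)]
    exact D.pfaffian_sFam_b_ne_zero t y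
  obtain ⟨u, v, hu, hv, hIu, hxv, huv⟩ :=
    generalized_tube_lemma isCompact_Icc isCompact_singleton hopen hsub
  have hv₀ : φ x₀ ∈ v := hxv (mem_singleton _)
  refine ⟨φ.source ∩ φ ⁻¹' v, ?_, ?_⟩
  · exact (continuousOn_extChartAt x₀).isOpen_inter_preimage (isOpen_extChartAt_source x₀) hv
      |>.mem_nhds ⟨mem_extChartAt_source x₀, hv₀⟩
  · rintro z ⟨hzs, hzv⟩ t ht
    have hmem : ((t, φ z) : ℝ × E4) ∈ u ×ˢ v := ⟨hIu ht, hzv⟩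
    exact (D.pfaffian_Arep_ne_zero_iff x₀ t hzs).1 (huv hmem).2

end NoT2

section WithT2

variable [CompactSpace S] [Nonempty S] [T2Space S]

/-- **`β = prim τ`**: the primitive of `τ` near the surface. [cite: McDuffSalamon2017, Lemma 3.2.1] -/
def β : MForm (𝓡 4) N ℝ 1 := D.prim D.τ

/-- `β` is smooth on the quarter tube. [folklore] -/
theorem smoothAt_β {x : N} (hx : x ∈ D.Tq) : D.β.SmoothAt x :=
  D.smoothAt_prim (fun _ hx ↦ D.smoothAt_τ hx) hx

/-- **`dβ = τ` on the quarter tube.** [cite: McDuffSalamon2017, Lemma 3.2.1] -/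
theorem mextDeriv_β {x : N} (hx : x ∈ D.Tq) : mextDeriv D.β x = D.τ x :=
  D.mextDeriv_prim (fun _ hx ↦ D.smoothAt_τ hx) (fun _ hx ↦ D.mextDeriv_τ hx) D.τ_b hx

/-- **`β = 0` at the points of the surface.** [folklore] -/
theorem β_b (y : S) : D.β (D.b y) = 0 := D.prim_b y

/-- **The chart representative of `β`**: `Brep x₀ q = β.inChart x₀ q`. [folklore] -/
def Brep (x₀ : N) (q : E4) : E4 [⋀^Fin 1]→L[ℝ] ℝ := D.β.inChart x₀ q

/-- The good part of the chart target at `x₀`: chart points over `Tq`. [folklore] -/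
def tgtq (x₀ : N) : Set E4 := (extChartAt (𝓡 4) x₀).target ∩ (extChartAt (𝓡 4) x₀).symm ⁻¹' D.Tq

/-- `tgtq` is open. [folklore] -/
theorem isOpen_tgtq (x₀ : N) : IsOpen (D.tgtq x₀) :=
  (continuousOn_extChartAt_symm x₀).isOpen_inter_preimage (isOpen_extChartAt_target x₀) D.isOpen_Tq

/-- `tgtq ⊆ tgt₁`. [folklore] -/
theorem tgtq_subset_tgt₁ (x₀ : N) : D.tgtq x₀ ⊆ D.tgt₁ x₀ := fun _ hq ↦
  ⟨hq.1, D.N₃_subset_N₁ (D.Tq_subset_N₃ hq.2)⟩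

/-- **`Brep` is `C^∞`** on `tgtq`. [folklore] -/
theorem contDiffAt_Brep (x₀ : N) {q : E4} (hq : q ∈ D.tgtq x₀) : ContDiffAt ℝ ∞ (D.Brep x₀) q :=
  contDiffAt_inChart_of_smoothAt₁ x₀ hq.1 (D.smoothAt_β hq.2)

/-- `Brep` in terms of the value of `β`: `Bμ x₀ (φ z) = (β z) ∘ τ_{x₀ → z}`. [folklore] -/
theorem Brep_apply_of_mem_source (x₀ : N) {z : N} (hz : z ∈ (extChartAt (𝓡 4) x₀).source) :
    D.Brep x₀ (extChartAt (𝓡 4) x₀ z) =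
      ((D.β z : E4 [⋀^Fin 1]→L[ℝ] ℝ)).compContinuousLinearMap (tangentCoordChange (𝓡 4) x₀ z z) := by
  rw [Brep, MForm.inChart_eq_of_mem_target _ ((extChartAt (𝓡 4) x₀).map_source hz),
    (extChartAt (𝓡 4) x₀).left_inv hz]

/-- **The good neighbourhood of the surface**: the points of the quarter tube around which
`Pf (s_t) ≠ 0` for all `t ∈ [-1, 2]`. [folklore] -/
def O₂ : Set N := D.Tq ∩ {z | ∀ᶠ z' in 𝓝 z, ∀ t ∈ Itime, pfaffian (D.sFam t z') ≠ 0}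

/-- `O₂` is open. [folklore] -/
theorem isOpen_O₂ : IsOpen D.O₂ := D.isOpen_Tq.inter isOpen_setOf_eventually_nhds

/-- `O₂ ⊆ Tq`. [folklore] -/
theorem O₂_subset_Tq : D.O₂ ⊆ D.Tq := inter_subset_left

/-- The surface lies in `O₂`. [folklore] -/
theorem b_mem_O₂ (y : S) : D.b y ∈ D.O₂ := by
  refine ⟨D.b_mem_Tq y, ?_⟩
  obtain ⟨U, hU, h⟩ := D.exists_nhds_pfaffian_ne_zero y
  exact Filter.eventually_of_mem hU h

/-- The surface lies in `O₂`. [folklore] -/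
theorem range_b_subset_O₂ : range D.b ⊆ D.O₂ := by
  rintro _ ⟨y, rfl⟩; exact D.b_mem_O₂ y

/-- **On `O₂` the family is non-degenerate**: `Pf (s_t z) ≠ 0` for `t ∈ [-1, 2]`. [folklore] -/
theorem pfaffian_sFam_ne_zero {z : N} (hz : z ∈ D.O₂) {t : ℝ} (ht : t ∈ Itime) :
    pfaffian (D.sFam t z) ≠ 0 :=
  hz.2.self_of_nhds t ht

/-! ### The Moser vector field -/

/-- **The Moser vector field** `Y_t x = moserE4 (s_t x) (β x)`: `ι(Y_t) s_t = -β`.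
[cite: McDuffSalamon2017, §3.2] -/
def Y (t : ℝ) (x : N) : TangentSpace (𝓡 4) x := moserE4 (D.sFam t x) (D.β x)

/-- **The Moser equation** `s_t (Y_t, w) = -β (w)` on `O₂` for `t ∈ [-1, 2]`. [cite: McDuffSalamon2017, §3.2] -/
theorem sFam_Y {z : N} (hz : z ∈ D.O₂) {t : ℝ} (ht : t ∈ Itime) (w : TangentSpace (𝓡 4) z) :
    D.sFam t z ![D.Y t z, w] = -D.β z ![w] :=
  alt_two_moserE4 (D.pfaffian_sFam_ne_zero hz ht) _ w

/-- **The Moser field vanishes on the surface** (`β = 0` there). [folklore] -/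
theorem Y_b (t : ℝ) (y : S) : D.Y t (D.b y) = 0 := by
  rw [Y, D.β_b]
  exact moserE4_zero _

/-- **The Moser field read in the chart at `x₀` is the Moser vector of the representatives**
(naturality, `moserE4_comp`). [folklore] -/
theorem tangentCoordChange_Y (x₀ : N) {t : ℝ} (ht : t ∈ Itime) {z : N} (hzO : z ∈ D.O₂)
    (hz : z ∈ (extChartAt (𝓡 4) x₀).source) :
    tangentCoordChange (𝓡 4) z x₀ z (D.Y t z) =
      moserE4 (D.Arep x₀ (t, extChartAt (𝓡 4) x₀ z)) (D.Brep x₀ (extChartAt (𝓡 4) x₀ z)) := by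
  rw [D.Arep_apply_of_mem_source x₀ t hz, D.Brep_apply_of_mem_source x₀ hz]
  exact (moserE4_comp (α := D.sFam t z) (D.pfaffian_sFam_ne_zero hzO ht) (D.β z)
    (tangentCoordChange_cancel hz) (tangentCoordChange_cancel' hz)).symm

/-- The Moser vector of the representatives is `C^∞` on `Itimeᵒ × (chart points over O₂)`.
[folklore] -/
theorem contDiffAt_moserChart (x₀ : N) {p : ℝ × E4} (ht : p.1 ∈ Itime) (hq : p.2 ∈ D.tgtq x₀)
    (hO : (extChartAt (𝓡 4) x₀).symm p.2 ∈ D.O₂) :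
    ContDiffAt ℝ ∞ (fun p : ℝ × E4 ↦ moserE4 (D.Arep x₀ p) (D.Brep x₀ p.2)) p := by
  have hP : pfaffian (D.Arep x₀ p) ≠ 0 := by
    have hzs : (extChartAt (𝓡 4) x₀).symm p.2 ∈ (extChartAt (𝓡 4) x₀).source :=
      (extChartAt (𝓡 4) x₀).map_target hq.1
    have h := (D.pfaffian_Arep_ne_zero_iff x₀ p.1 hzs).2 (D.pfaffian_sFam_ne_zero hO ht)
    rwa [(extChartAt (𝓡 4) x₀).right_inv hq.1] at h
  have hpair : ContDiffAt ℝ ∞ (fun p : ℝ × E4 ↦ (D.Arep x₀ p, D.Brep x₀ p.2)) p :=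
    (D.contDiffAt_Arep x₀ (D.tgtq_subset_tgt₁ x₀ hq)).prodMk ((D.contDiffAt_Brep x₀ hq).comp p contDiffAt_snd)
  exact ContDiffAt.comp (f := fun p : ℝ × E4 ↦ (D.Arep x₀ p, D.Brep x₀ p.2))
    (g := fun q : (E4 [⋀^Fin 2]→L[ℝ] ℝ) × (E4 [⋀^Fin 1]→L[ℝ] ℝ) ↦ moserE4 q.1 q.2) p
    (contDiffAt_moserE4 hP) hpair

/-- **The Moser field is a smooth time-dependent vector field on `(-1, 2) × O₂`** (a `C^∞` map
into the tangent bundle; in the trivialization at `x₀` it is the Moser vector of the chart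
representatives). [cite: McDuffSalamon2017, §3.2] -/
theorem contMDiffOn_Y :
    ContMDiffOn (𝓘(ℝ, ℝ).prod (𝓡 4)) (𝓡 4).tangent ∞
      (fun p : ℝ × N ↦ (⟨p.2, D.Y p.1 p.2⟩ : TangentBundle (𝓡 4) N)) (Ioo (-1 : ℝ) 2 ×ˢ D.O₂) := by
  rintro ⟨t₀, x₀⟩ ⟨ht₀, hx₀⟩
  have ht₀' : t₀ ∈ Itime := Ioo_subset_Icc_self ht₀
  refine ContMDiffAt.contMDiffWithinAt ?_
  rw [contMDiffAt_totalSpace]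
  refine ⟨contMDiffAt_snd, ?_⟩
  -- the good open set around `(t₀, x₀)`
  set G : Set (ℝ × N) := Ioo (-1 : ℝ) 2 ×ˢ (D.O₂ ∩ (extChartAt (𝓡 4) x₀).source) with hG
  have hGo : IsOpen G := isOpen_Ioo.prod (D.isOpen_O₂.inter (isOpen_extChartAt_source x₀))
  have hGmem : ((t₀, x₀) : ℝ × N) ∈ G := ⟨ht₀, hx₀, mem_extChartAt_source x₀⟩
  have hev : (fun p : ℝ × N ↦
      (trivializationAt E4 (TangentSpace (𝓡 4)) x₀ ⟨p.2, D.Y p.1 p.2⟩).2) =ᶠ[𝓝 (t₀, x₀)]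
      fun p ↦ moserE4 (D.Arep x₀ (p.1, extChartAt (𝓡 4) x₀ p.2)) (D.Brep x₀ (extChartAt (𝓡 4) x₀ p.2)) := by
    filter_upwards [hGo.mem_nhds hGmem] with p hp
    rw [TangentBundle.trivializationAt_apply]
    exact D.tangentCoordChange_Y x₀ (Ioo_subset_Icc_self hp.1) hp.2.1 hp.2.2
  refine ContMDiffAt.congr_of_eventuallyEq ?_ hev
  have h1 : ContMDiffAt (𝓘(ℝ, ℝ).prod (𝓡 4)) 𝓘(ℝ, ℝ × E4) ∞
      (fun p : ℝ × N ↦ (p.1, extChartAt (𝓡 4) x₀ p.2)) (t₀, x₀) :=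
    contMDiffAt_fst.prodMk_space ((contMDiffAt_extChartAt (x := x₀)).comp _ contMDiffAt_snd)
  have hq : extChartAt (𝓡 4) x₀ x₀ ∈ D.tgtq x₀ := ⟨mem_extChartAt_target x₀, by
    show (extChartAt (𝓡 4) x₀).symm (extChartAt (𝓡 4) x₀ x₀) ∈ D.Tq
    rw [extChartAt_to_inv]; exact D.O₂_subset_Tq hx₀⟩
  have hO : (extChartAt (𝓡 4) x₀).symm (extChartAt (𝓡 4) x₀ x₀) ∈ D.O₂ := by
    rw [extChartAt_to_inv]; exact hx₀
  exact ContDiffAt.comp_contMDiffAt (f := fun p : ℝ × N ↦ (p.1, extChartAt (𝓡 4) x₀ p.2))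
    (x := (t₀, x₀)) (D.contDiffAt_moserChart x₀ (p := (t₀, extChartAt (𝓡 4) x₀ x₀)) ht₀' hq hO) h1

end WithT2

end Setup

end SurfaceTube

end Literature.Geometry.Symplectic
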